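import Mathlib.RingTheory.IntegralDomain
import Mathlib.RingTheory.Ideal.Quotient.Operations
import Mathlib.RingTheory.LocalRing.MaximalIdeal.Basic
import HarnessLib

/-!
# A non-trivial character sums to zero over every coset of a subgroup on which it is non-trivial — in particular over the congruence cosets `x₀·(1 + 𝔪^a)` of `(R ⧸ 𝔪^n)ˣ`
# (Labesse–Langlands 1979, §2 (2.2) p. 9: `∫_{|x| < |ϖ|^N} κ(x) dx = 0` for a RAMIFIED `κ`; Serre, *A Course in Arithmetic*, VI §1 Prop. 4; Washington, *Cyclotomic Fields*, Lemma 4.7)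

Topic `NumberTheory/LocalFields`, namespace `Literature.NumberTheory.LocalFields.CharacterSum`.  THEOREMS ONLY: no definition, no named fact, no instance, no notation, no `sorry`.
Cell `pub/hodgecm-mathlib` (D-0151), crux H413 = `stmt-HodgeConjecture-24833`; road «R1LL-WILD» (LEAD F0P3a-plan (g10) WORD T9-22 (4) «opportunistic bricks»; A-p12 (g19) census
`CENSUS-R1LL-wild.A-p12g19.md` §2 (W′4) «DEEP SHELLS CANCEL»), brick **(W′4)-GEN** (A-p01 (g21); architect A-p16 (g28) RULING A-25 (d)): the GENERIC half of Labesse–Langlands'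
cancellation (2.2) — the orthogonality of a character that is non-trivial on a subgroup, summed over any coset of that subgroup — in the `R ⧸ 𝔪^n` currency of ★ R2-A
`RamifiedQuadraticNormFibres`.  The arithmetic reading (`R = 𝒪[L⁺_v]`, `κ = ω_{L∕L⁺, v}` ramified ⇒ non-trivial on the units ∕ on `1 + 𝔪^{c−1}`) is (W′4) proper (A-p12).
HONEST LABEL: HC_CM is proved only modulo the printed citations (hLiu418, h413) until rung 0 closes; nothing printed is a letter here — finite character orthogonality.

* §1 GROUPS: `sum_subtype_subgroup_eq_zero_of_exists_ne_one` (`Σ_{h ∈ H} f h = 0` if `f|_H ≠ 1`, Mathlib `sum_hom_units_eq_zero` on `f ∘ H.subtype`), the COSET form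
  **`sum_mul_subgroup_eq_zero`** (`Σ_{h ∈ H} f (x₀ h) = 0`), the FIBRE form **`sum_fibre_eq_zero_of_exists_ker_ne_one`** (`φ : G →* G′`, `f` non-trivial on `ker φ` ⇒
  `Σ_{g : φ g = y} f g = 0` for every `y`).
* §2 CONGRUENCE COSETS of `(R ⧸ 𝔪^n)ˣ` (`R` local, `a ≤ n`): **`sum_units_congr_eq_zero`** — if `f : (R ⧸ 𝔪^n)ˣ →* M` is non-trivial on the congruence subgroup
  `ker ((R ⧸ 𝔪^n)ˣ → (R ⧸ 𝔪^a)ˣ)` («conductor exponent `> a`»), then `Σ_{u ≡ u₀ (𝔪^a)} f u = 0` for every unit class `u₀`; `a = 0`-free form **`sum_units_eq_zero_of_ne_one`**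
  (`Σ_{u} f u = 0`, the «`κ` ramified ⇒ every shell cancels» of LL p. 9).

## References
* [LabesseLanglands1979] J.-P. Labesse, R. P. Langlands, *L-indistinguishability for SL(2)*, Canad. J. Math. 31 (1979), §2 (2.2) p. 9.
* [Serre1973CourseArithmetic] J.-P. Serre, *A Course in Arithmetic* (1973), Ch. VI §1 Prop. 4 (orthogonality of characters of a finite abelian group).
* [Washington1997] L. C. Washington, *Introduction to Cyclotomic Fields*, 2nd ed. (1997), Lemma 4.7 / §3 (character sums over congruence classes vanish above the conductor).
-/

set_option autoImplicit false

namespace Literature.NumberTheory.LocalFields.CharacterSum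

open IsLocalRing

/-! ## §1 Orthogonality over a subgroup, its cosets, and the fibres of a homomorphism -/

section Group

variable {G M : Type*} [CommGroup G] [CommRing M] [IsDomain M] (f : G →* M)

/-- **`Σ_{h ∈ H} f h = 0`** for a finite subgroup `H` on which the multiplicative character `f : G →* M` (`M` a domain) is NON-TRIVIAL — Mathlib `sum_hom_units_eq_zero` for
`f ∘ H.subtype`. [cite: Serre1973CourseArithmetic, Ch. VI §1 Prop. 4] -/
theorem sum_subtype_subgroup_eq_zero_of_exists_ne_one (H : Subgroup G) [Fintype H] (hf : ∃ h ∈ H, f h ≠ 1) : ∑ h : H, f h = 0 := by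
  have hne : f.comp H.subtype ≠ 1 := by
    obtain ⟨h, hh, hfh⟩ := hf
    intro h1
    exact hfh (by simpa using DFunLike.congr_fun h1 ⟨h, hh⟩)
  simpa using sum_hom_units_eq_zero (f.comp H.subtype) hne

/-- **THE COSET FORM: `Σ_{h ∈ H} f (x₀ · h) = f x₀ · Σ_{h ∈ H} f h = 0`** (`f|_H ≠ 1`). [cite: Serre1973CourseArithmetic, Ch. VI §1 Prop. 4] [cite: LabesseLanglands1979, §2 (2.2) p. 9] -/
theorem sum_mul_subgroup_eq_zero (H : Subgroup G) [Fintype H] (hf : ∃ h ∈ H, f h ≠ 1) (x₀ : G) : ∑ h : H, f (x₀ * h) = 0 := by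
  simp_rw [map_mul, ← Finset.mul_sum, sum_subtype_subgroup_eq_zero_of_exists_ne_one f H hf, mul_zero]

/-- **THE FIBRE FORM**: for a homomorphism `φ : G →* G′` and `f : G →* M` NON-TRIVIAL ON `ker φ`, the sum of `f` over every (finite) fibre `{g | φ g = y}` vanishes — the fibre is
empty or a coset `x₀ · ker φ`. [cite: Serre1973CourseArithmetic, Ch. VI §1 Prop. 4] [cite: Washington1997, Lemma 4.7] -/
theorem sum_fibre_eq_zero_of_exists_ker_ne_one {G' : Type*} [CommGroup G'] (φ : G →* G') [Fintype φ.ker] (hf : ∃ k ∈ φ.ker, f k ≠ 1) (y : G')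
    [Fintype {g : G // φ g = y}] : ∑ g : {g : G // φ g = y}, f g = 0 := by
  classical
  by_cases hy : ∃ x₀ : G, φ x₀ = y
  · obtain ⟨x₀, rfl⟩ := hy
    -- the fibre over `φ x₀` is `x₀ · ker φ`
    have e : ∑ g : {g : G // φ g = φ x₀}, f g = ∑ k : φ.ker, f (x₀ * k) := by
      refine Fintype.sum_equiv (Equiv.subtypeEquiv (Equiv.mulLeft x₀⁻¹) fun g => ?_) _ _ fun g => ?_
      · rw [Equiv.coe_mulLeft, MonoidHom.mem_ker, map_mul, map_inv, inv_mul_eq_one, eq_comm]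
      · simp
    rw [e]
    exact sum_mul_subgroup_eq_zero f φ.ker hf x₀
  · haveI : IsEmpty {g : G // φ g = y} := ⟨fun g => hy ⟨g.1, g.2⟩⟩
    exact Fintype.sum_empty _

end Group

/-! ## §2 Congruence cosets of `(R ⧸ 𝔪^n)ˣ` -/

section Congruence

variable {R : Type*} [CommRing R] [IsLocalRing R] {M : Type*} [CommRing M] [IsDomain M]

/-- **ALL UNITS** (`a = 0`): a NON-TRIVIAL multiplicative character of the finite group `(R ⧸ 𝔪^n)ˣ` sums to zero — «`κ` ramified ⇒ the sum over every shell of units vanishes»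
(Labesse–Langlands' `∫_{|x| = |ϖ|^m} κ = 0`). [cite: LabesseLanglands1979, §2 (2.2) p. 9] [cite: Serre1973CourseArithmetic, Ch. VI §1 Prop. 4] -/
theorem sum_units_eq_zero_of_ne_one {n : ℕ} [Fintype (R ⧸ maximalIdeal R ^ n)ˣ] (f : (R ⧸ maximalIdeal R ^ n)ˣ →* M) (hf : f ≠ 1) :
    ∑ u : (R ⧸ maximalIdeal R ^ n)ˣ, f u = 0 :=
  sum_hom_units_eq_zero f hf

/-- **CONGRUENCE COSETS**: `a ≤ n`, `f : (R ⧸ 𝔪^n)ˣ →* M` NON-TRIVIAL on the congruence subgroup `ker ((R ⧸ 𝔪^n)ˣ → (R ⧸ 𝔪^a)ˣ)` = «`1 + 𝔪^a`» (conductor exponent `> a`): for every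
unit class `u₀ mod 𝔪^a`, `Σ_{u ∈ (R ⧸ 𝔪^n)ˣ, u ≡ u₀ (𝔪^a)} f u = 0` — the finite form of `∫_{u₀ + 𝔭^a} κ(x) dx = 0`. [cite: LabesseLanglands1979, §2 (2.2) p. 9] [cite: Washington1997, Lemma 4.7] -/
theorem sum_units_congr_eq_zero {n a : ℕ} (ha : a ≤ n) (f : (R ⧸ maximalIdeal R ^ n)ˣ →* M)
    [Fintype (Units.map (Ideal.Quotient.factor (Ideal.pow_le_pow_right ha : maximalIdeal R ^ n ≤ maximalIdeal R ^ a)).toMonoidHom).ker]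
    (hf : ∃ k ∈ (Units.map (Ideal.Quotient.factor (Ideal.pow_le_pow_right ha : maximalIdeal R ^ n ≤ maximalIdeal R ^ a)).toMonoidHom).ker, f k ≠ 1)
    (u₀ : (R ⧸ maximalIdeal R ^ a)ˣ)
    [Fintype {u : (R ⧸ maximalIdeal R ^ n)ˣ // Units.map (Ideal.Quotient.factor (Ideal.pow_le_pow_right ha : maximalIdeal R ^ n ≤ maximalIdeal R ^ a)).toMonoidHom u = u₀}] :
    ∑ u : {u : (R ⧸ maximalIdeal R ^ n)ˣ // Units.map (Ideal.Quotient.factor (Ideal.pow_le_pow_right ha : maximalIdeal R ^ n ≤ maximalIdeal R ^ a)).toMonoidHom u = u₀}, f u = 0 :=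
  sum_fibre_eq_zero_of_exists_ker_ne_one f _ hf u₀

/-- **Membership in the congruence subgroup, on representatives**: for units `x, y` of `R` (so that `mk x`, `mk y` are units of `R ⧸ 𝔪^n`), the classes have the same image in
`(R ⧸ 𝔪^a)ˣ` iff `x − y ∈ 𝔪^a` — the dictionary «`u ≡ u₀ (𝔪^a)`» ⟷ «`u ∈ u₀·(1 + 𝔪^a)`» used to read §2 on shells of the tree. [cite: Washington1997, Lemma 4.7] -/
theorem units_map_factor_eq_iff {n a : ℕ} (ha : a ≤ n) (x y : (R ⧸ maximalIdeal R ^ n)ˣ) :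
    Units.map (Ideal.Quotient.factor (Ideal.pow_le_pow_right ha : maximalIdeal R ^ n ≤ maximalIdeal R ^ a)).toMonoidHom x =
        Units.map (Ideal.Quotient.factor (Ideal.pow_le_pow_right ha : maximalIdeal R ^ n ≤ maximalIdeal R ^ a)).toMonoidHom y ↔
      ∀ x' y' : R, Ideal.Quotient.mk (maximalIdeal R ^ n) x' = (x : R ⧸ maximalIdeal R ^ n) →
        Ideal.Quotient.mk (maximalIdeal R ^ n) y' = (y : R ⧸ maximalIdeal R ^ n) → x' - y' ∈ maximalIdeal R ^ a := by
  constructor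
  · intro h x' y' hx hy
    have h' := congrArg (fun u : (R ⧸ maximalIdeal R ^ a)ˣ => (u : R ⧸ maximalIdeal R ^ a)) h
    simp only [Units.coe_map, RingHom.toMonoidHom_eq_coe, MonoidHom.coe_coe, ← hx, ← hy, Ideal.Quotient.factor_mk] at h'
    exact (Ideal.Quotient.eq).1 h'
  · intro h
    obtain ⟨x', hx⟩ := Ideal.Quotient.mk_surjective (x : R ⧸ maximalIdeal R ^ n)
    obtain ⟨y', hy⟩ := Ideal.Quotient.mk_surjective (y : R ⧸ maximalIdeal R ^ n)
    ext
    simp only [Units.coe_map, RingHom.toMonoidHom_eq_coe, MonoidHom.coe_coe, ← hx, ← hy, Ideal.Quotient.factor_mk]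
    exact (Ideal.Quotient.eq).2 (h x' y' hx hy)

end Congruence

end Literature.NumberTheory.LocalFields.CharacterSum
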